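import Literature.MathematicalPhysics.QuantumFieldTheory.Balaban1983to89.B6Prop22MultiLevelBoxL0
import Literature.MathematicalPhysics.QuantumFieldTheory.Balaban1983to89.B6Ineq268From267
import Literature.MathematicalPhysics.QuantumFieldTheory.Balaban1983to89.B6Geom246MultiLevelBoxL0
import Literature.MathematicalPhysics.QuantumFieldTheory.Balaban1983to89.B6MultiLevelBoxOperatorL0

/-!
# `Balaban1983to89.B6Ineq268MultiLevelBoxL0` — LEVEL-0 TWIN (programme G-F3′-L0, director-ym LINE №27 / UV3-NODE §24.5; plan `lit-balaban-r03/G-F3L0-PLAN.md`) of `B6Ineq268MultiLevelBox`: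
the same declarations, SAME NAMES AND STATEMENTS, for nested families WITH print's region `Λ₀ = T ∖ Ω₁` ADMITTED (structures
`B6MultiLevelBoxOperatorL0.Domains` / `B6MultiLevelTorusOperatorL0.TDomains`: levels `0, …, k`, the level-`0` block a single site, `Q′₀ = id`,
finite weight `a₀` — print p.225 (2.14) «Σ_{j=0}^k … (Q′₀λ)(x) = λ(x), x ∈ Λ₀», p.229 «taking a sequence (2.1) … smallest possible domains B^j(Λ_j),
and considering the operator Δ_a defined by (2.19), (2.20) for this sequence»).  Every `D`-free object is the lineage's, consumed BY NAME; no existing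
module is touched; no fact is minted.  Unit `lit-balaban-r03` (B6 fold owner, r03 gen 36); referee ref-4.  THE TWIN'S DOCUMENTATION FOLLOWS
VERBATIM (its «levels 1 … k» / «Ω₁ = X» sentences describe the twin; here `j` runs from `0` and `Ω₁` may be a proper subset).

# `Balaban1983to89.B6Ineq268MultiLevelBox` — [B6] (2.68)–(2.69) FOR THE GENUINE `k`-LEVEL OPERATOR ON A BOX:
the (2.69)-kernel `X(y, y′)` of `Q′G′²Q′*` for `G′ = Δ′_a⁻¹` of an ARBITRARY nested family (2.1)–(2.2) on a Neumann box
satisfies `|(Q′G′²Q′*)(y, y′)| ≤ O(1)(L^jη)⁴(L^{j′}η)^{−d}e^{−¼δ₀d(y,y′)}` uniformly in `k` (file 1 of the `k`-level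
Proposition 2.3 programme of seat p21; no existing module is touched; no fact is minted)

FRAMING (verbatim cell line):
statement-level skeleton of published theorems with citation tags; proofs where landed; nothing here is a claim about the Yang–Mills mass gap

Source under audit (cell pub-balaban / lit-balaban): T. Bałaban, *Propagators and renormalization transformations for
lattice gauge theories. II*, Commun. Math. Phys. **96** (1984) 223–250 [`Balaban1984PropagatorsII`, "B6"], p. 235 [PDF 13]
(2.68)–(2.69) (held text `paper:balaban1984-cmp96-propagators-rt-ii` p0013, read this generation).  Unit `lit-balaban-p21`
(Phase-2 proof seat p21 gen 13), HOME `run/shared/lean/pub/lit-balaban/`, free-target protocol G.5-34(d), B6 fold owner r03,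
referee ref-4.

## WHAT IS PRINTED (p. 235, verbatim up to notation)

«Let us consider now the operator Q′G′²Q′* and its inverse (Q′G′²Q′*)⁻¹. The inequalities (2.67) imply
|(Q′G′²Q′*)(y, y′)| = |Σ_{y″∈𝔅}(Q′G′Δ(y″)G′Q′*)(y, y′)| ≤ Σ_{y″∈𝔅} O(1)(L^jη)²e^{−½δ₀d(y,y″)}(L^{j″}η)²(L^{j′}η)^{−d}
e^{−½δ₀d(y″,y′)} ≤ … ≤ O(1)(L^jη)⁴(L^{j′}η)^{−d}e^{−¼δ₀d(y,y′)}, (2.68) where we have used the inequalities (2.60), (2.63)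
of Lemma 1. … ⟨λ, λ′⟩ = Σ_{j=0}^{k}Σ_{y∈Λ_j}(L^jη)^dλ(y)λ′(y). (2.69)»

## WHAT THIS FILE CERTIFIES (kernel-checked; setting of `B6MultiLevelBoxOperator` / `B6Geom246MultiLevelBox`)

For every nested family `D : Domains d ℓ M_h k P R` (levels `1 … k` on the fine box `X = Π_μ[0, L^k·L·M_h·P_μ)`, lattice
units `η = 1`, spatial dimension `d + 1`), weights `a_j` in a window with `a_{i+1} = aNext ℓ a_i c_i`, and the GENUINE
`k`-level operator `G′ = gml = Δ′_a⁻¹` of `B6MultiLevelBoxOperator`: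
* §1 the (2.69) data on `𝔅 = bset D`: weights `W(y) = (L^jη)^{d+1}` (`W`), the normalised block average `Q′` with kernel
  `q(y, x) = W(y)⁻¹·[x ∈ B^j(y)]` (`qB`, `QB = avgOp qB`), its (2.69)-adjoint `Q′*` = block-constant extension
  (`QsB = avgAdj 1 W qB`, `QsB_apply`), the block count `#B^j(y) ≤ L^{j(d+1)}` (`card_blkOf_le`), the two averaging
  normalisations `Σ_x|q(y,x)| ≤ 1`, `|q(y,x)| ≤ 1/W(y)` (`sum_abs_qB_le`, `abs_qB_le`), and `X = kernelW W (Q′G′G′Q′*)`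
  (`Xk`) with `kerOp W X = Q′G′²Q′*` (`kerOp_Xk`);
* §2 the geometry `geomB D` of the `k`-level Prop. 2.3 chain: p21's realised (2.46) geometry `geom D` (sites `𝔅`,
  `d` = the bond-graph distance, scale = level, `L`, `η = 1`) with print's `M := L·M_h` and the (2.60)-certified
  `R := R − 1/(L·M_h)` — the tree certifies the walk form of (2.2) with the constant `RM − 1` (`B6Geom246MultiLevelBoxL0.levelGap`),
  and the abstract assembly modules read `R`, `M` only through the product `R·M` in (2.60) and the thresholds —; realised
  (`realizesB`), `LevelSep` (2.60) (`levelSepB`), (2.54)/symmetry (`triangleB`, `symmB`);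
* §3 **(2.68) FOR THE GENUINE `k`-LEVEL OPERATOR** (`ineq268_multiLevelBox`): there are `δ₀, C, M₀, N₀ > 0` (depending on
  `d, L` and the weight window only) such that for every `k ≥ 1`, `M_h ≥ 3` with `L·M_h ≥ M₀`, `R ≥ 2L` with
  `R·L·M_h ≥ N₀ + 1`, every `P`, every nested family `D` and every windowed weight sequence,
  `|X(y, y′)| ≤ C·(L^j)⁴·(L^{j′})^{−(d+1)}·e^{−¼δ₀d(y,y′)}` AND the weighted form `|(L^{j″})^{d+1}X(y, y″)| ≤
  C·(L^j)⁴·e^{−½(½δ₀)d(y,y″)}` (= the hypothesis `hX` of `B6Prop23TwoLevel.prop23_assembled_twoLevel` at its rate `½δ₀`),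
  where `δ₀` is the (2.67)₁ rate of `B6Prop22MultiLevelBoxL0.prop22_first_multiLevelBox` (majorant `e^{−½δ₀d}`) — i.e. the
  printed passage `½δ₀ ↦ ¼δ₀`.  Proof = the print's: p01's kernel-checked derivation `B6Ineq268From267.ineq268_of_267`
  ((2.67)₁ twice around `Σ_{y″}Δ(y″) = I`, then (2.54), (2.60), (2.61) at `α = ¼`, threshold `L² ≤ e^{¼δ₀(RM−1)}`) fed with
  the genuine `k`-level inputs: (2.67)₁ = `prop22_first_multiLevelBox`, Lemma 2.1 on the box = `lemma21_box` (α = ¼),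
  (2.60) = `levelGap`.

## HONEST SCOPE

* Neumann box instead of the torus; levels `1 … k` (`Ω₁ = X`); lattice units; `A = 0` — exactly the scope of the
  `k`-level Prop. 2.2 chain (files `B6MultiLevelBoxOperator` … `B6Prop22MultiLevelBox`).
* The O(1) of (2.68) is `C²·L²·c + 1` with `C` the (2.67)₁ constant and `c = K261 N₁ (d+1) L 1 (¼δ₀)` the (2.61)
  constant of `B6Ineq261LevelGap` on the realised box geometry (L-dependent, `k`-uniform; the printed `c₁(α)` is refuted
  as typed, GAPS G-A11-1); «M sufficiently large» / «RM sufficiently large» are the explicit thresholds `M₀`, `N₀`.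
* Nothing is inferred from the manuscript: every step is kernel-checked; the quoted sentences locate the statements.
-/

namespace Literature.MathematicalPhysics.QuantumFieldTheory.Balaban1983to89.B6Ineq268MultiLevelBoxL0

open Finset Matrix
open Literature.MathematicalPhysics.QuantumFieldTheory.Balaban1983to89.B4Reflection242 (boxDom mem_boxDom blk)
open Literature.MathematicalPhysics.QuantumFieldTheory.Balaban1983to89.B6MultiLevelBoxOperator hiding Domains mlOp_apply
open Literature.MathematicalPhysics.QuantumFieldTheory.Balaban1983to89.B6MultiLevelBoxOperatorL0
open Literature.MathematicalPhysics.QuantumFieldTheory.Balaban1983to89.B6Geom246MultiLevelBox hiding Touch blkOf blkOf_corner blkOf_eq_iff_blk blkOf_eq_of_blk_i_eq blkOf_val bond bond_adj bset cen connected coord_bounds corner corner_mem csys dist_blkOf_le_box dist_blkOf_le_coord dist_blkOf_le_line dist_cen_le_of_adj dist_cen_le_of_touch dist_le_one_of_near dist_toR_cen_le exists_blkOf_eq geom lemma21_box lev_corner lev_eq_of_blkOf_eq levelGap pack reachable_blkOf reachable_of_near realizes scale_bounds touch_symm triangle_refl_nonneg walk_disp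
open Literature.MathematicalPhysics.QuantumFieldTheory.Balaban1983to89.B6Geom246MultiLevelBoxL0
open Literature.MathematicalPhysics.QuantumFieldTheory.Balaban1983to89.B6Prop22MultiLevelBoxL0 (prop22_first_multiLevelBox)
open Literature.MathematicalPhysics.QuantumFieldTheory.Balaban1983to89.B6RandomWalk (HasMajorant BlockSupp)
open Literature.MathematicalPhysics.QuantumFieldTheory.Balaban1983to89.B6Ineq261LevelGap (K261 K261_nonneg
  theta_lt_one_of_log)
open Literature.MathematicalPhysics.QuantumFieldTheory.Balaban1983to89.B6Ineq2142 (avgOp avgAdj kernelW avgOp_apply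
  kerOp_kernelW)
open Literature.MathematicalPhysics.QuantumFieldTheory.Balaban1983to89.B6Ineq243TwoLevelBox (aNext)
open Literature.MathematicalPhysics.QuantumFieldTheory.Balaban1983to89.B6Geometry (ContourSystem Realizes
  dist_comm_of_realizes triangle254_of_realizes ineq260_of_levelGap)
open Literature.MathematicalPhysics.QuantumFieldTheory.Balaban1983to89.B6Expansion282 (kerOp)

noncomputable section

variable {d : ℕ}

/-! ## §1 The (2.69) data on `𝔅`: weights, the block average `Q′`, its adjoint `Q′*`, the kernel `X` of `Q′G′²Q′*` -/

section Data

variable {ℓ Mh k R : ℕ} {P : Fin (d + 1) → ℕ} (D : Domains d ℓ Mh k P R)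

/-- `L^jη = L^j` on the box geometry (lattice units). [cite: Balaban1984PropagatorsII, (2.1) p.224 («L^jη»), dictionary] -/
theorem geom_len (y : ↥(B6Geom246MultiLevelBoxL0.bset D)) : (geom D).len y = ((ℓ : ℝ) + 1) ^ y.1.1 * 1 := rfl

/-- **the weights of the pairing (2.69)**: `W(y) = (L^jη)^{d+1}` for `y ∈ Λ_j` (spatial dimension `d + 1`, lattice units).
[cite: Balaban1984PropagatorsII, (2.69) p.235] -/
def W : ↥(bset D) → ℝ := fun y => (geom D).len y ^ (d + 1)

/-- `W(y) = L^{j(d+1)}`. [cite: Balaban1984PropagatorsII, (2.69) p.235, dictionary] -/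
theorem W_eq (y : ↥(bset D)) : W D y = (((ℓ : ℝ) + 1) ^ y.1.1) ^ (d + 1) := by
  unfold W; rw [geom_len, mul_one]

/-- `W(y) > 0`. [cite: Balaban1984PropagatorsII, (2.69) p.235, dictionary] -/
theorem W_pos (y : ↥(bset D)) : 0 < W D y := by
  rw [W_eq]; positivity

/-- **the kernel of the normalised block average `Q′`** (lattice units): `q(y, x) = L^{−j(d+1)}·[x ∈ B^j(y)] = W(y)⁻¹·[x ∈ B^j(y)]`
— «(Q′_jλ)(y)», the mean of `λ` over the block `B^j(y)`. [cite: Balaban1984PropagatorsII, (2.14)–(2.15) p.225, (2.69) p.235] -/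
def qB : ↥(bset D) → ↥(boxDom (N0 ℓ Mh k P)) → ℝ := fun y x => if blkOf D x = y then (W D y)⁻¹ else 0

/-- `Q′` as a linear operator from fine-lattice functions to functions on `𝔅`. [cite: Balaban1984PropagatorsII, (2.14) p.225] -/
def QB : (↥(boxDom (N0 ℓ Mh k P)) → ℝ) →ₗ[ℝ] (↥(bset D) → ℝ) := avgOp (qB D)

/-- `Q′*`, the adjoint of `Q′` for the pairing (2.69) on `𝔅` and the flat pairing (`η^{d+1} = 1`) on the fine box.
[cite: Balaban1984PropagatorsII, (2.69) p.235, p.248] -/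
def QsB : (↥(bset D) → ℝ) →ₗ[ℝ] (↥(boxDom (N0 ℓ Mh k P)) → ℝ) := avgAdj 1 (W D) (qB D)

/-- the kernel is carried by the block: `q(y, x) ≠ 0 ⇒ x ∈ B^j(y)`. [cite: Balaban1984PropagatorsII, (2.14) p.225] -/
theorem qB_ne_zero {y : ↥(bset D)} {x : ↥(boxDom (N0 ℓ Mh k P))} (h : qB D y x ≠ 0) : blkOf D x = y := by
  unfold qB at h
  by_contra hne
  exact h (if_neg hne)

/-- `|q(y, x)| = q(y, x)` is `W(y)⁻¹` on the block and `0` off it. [cite: Balaban1984PropagatorsII, (2.14) p.225, dictionary] -/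
theorem abs_qB (y : ↥(bset D)) (x : ↥(boxDom (N0 ℓ Mh k P))) :
    |qB D y x| = if blkOf D x = y then (W D y)⁻¹ else 0 := by
  unfold qB
  split_ifs with h
  · exact abs_of_pos (inv_pos.2 (W_pos D y))
  · exact abs_zero

/-- **the block count**: `#B^j(y) ≤ L^{j(d+1)} = W(y)` (the sites of the block inject into the offsets `[0, L^j)^{d+1}`).
[cite: Balaban1984PropagatorsII, (2.1) p.224 («unit lattice … L^j»), dictionary] -/
theorem card_blkOf_le (y : ↥(bset D)) :
    (((Finset.univ.filter fun x : ↥(boxDom (N0 ℓ Mh k P)) => blkOf D x = y).card : ℕ) : ℝ) ≤ W D y := by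
  classical
  set n : ℕ := (ℓ + 1) ^ y.1.1 with hn
  have key : (Finset.univ.filter fun x : ↥(boxDom (N0 ℓ Mh k P)) => blkOf D x = y).card ≤
      Fintype.card (Fin (d + 1) → Fin n) := by
    rw [← Fintype.card_subtype]
    refine Fintype.card_le_of_injective
      (fun x : {x : ↥(boxDom (N0 ℓ Mh k P)) // blkOf D x = y} => fun μ =>
        (⟨(x.1.1 μ - (n : ℤ) * y.1.2 μ).toNat, ?_⟩ : Fin n)) ?_
    · have h := coord_bounds D x.2 μ
      have h0 : 0 ≤ x.1.1 μ - (n : ℤ) * y.1.2 μ := by rw [hn]; omega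
      have h1 : x.1.1 μ - (n : ℤ) * y.1.2 μ < n := by rw [hn]; omega
      exact (Int.toNat_lt h0).2 h1
    · intro x x' h
      apply Subtype.ext; apply Subtype.ext; funext μ
      have hμ := congrArg (fun f : Fin (d + 1) → Fin n => ((f μ : Fin n) : ℕ)) h
      simp only at hμ
      have h0 : 0 ≤ x.1.1 μ - (n : ℤ) * y.1.2 μ := by have := coord_bounds D x.2 μ; rw [hn]; omega
      have h0' : 0 ≤ x'.1.1 μ - (n : ℤ) * y.1.2 μ := by have := coord_bounds D x'.2 μ; rw [hn]; omega
      have e : ((x.1.1 μ - (n : ℤ) * y.1.2 μ).toNat : ℤ) = ((x'.1.1 μ - (n : ℤ) * y.1.2 μ).toNat : ℤ) := by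
        exact_mod_cast hμ
      rw [Int.toNat_of_nonneg h0, Int.toNat_of_nonneg h0'] at e
      linarith
  calc (((Finset.univ.filter fun x : ↥(boxDom (N0 ℓ Mh k P)) => blkOf D x = y).card : ℕ) : ℝ)
      ≤ (Fintype.card (Fin (d + 1) → Fin n) : ℝ) := by exact_mod_cast key
    _ = W D y := by
        rw [Fintype.card_fun, Fintype.card_fin, Fintype.card_fin, W_eq, hn]
        push_cast; ring

/-- **the ℓ¹-normalisation of the block average**: `Σ_x |q(y, x)| ≤ 1` (κ₁ = 1).
[cite: Balaban1984PropagatorsII, (2.14) p.225 («(Q′_jλ)(y)», a mean), (2.68) p.235] -/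
theorem sum_abs_qB_le (y : ↥(bset D)) : ∑ x, |qB D y x| ≤ 1 := by
  classical
  have hW := W_pos D y
  rw [Finset.sum_congr rfl fun x _ => abs_qB D y x, Finset.sum_ite, Finset.sum_const_zero, add_zero,
    Finset.sum_const, nsmul_eq_mul, ← div_eq_mul_inv, div_le_one hW]
  exact card_blkOf_le D y

/-- **the volume normalisation**: `|q(y, x)| ≤ 1·1/W(y)` (κ₂ = 1, fine weight `w_X = η^{d+1} = 1`).
[cite: Balaban1984PropagatorsII, (2.14) p.225, (2.69) p.235] -/
theorem abs_qB_le (y : ↥(bset D)) (x : ↥(boxDom (N0 ℓ Mh k P))) : |qB D y x| ≤ 1 * 1 / (geom D).len y ^ (d + 1) := by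
  rw [abs_qB, one_mul, one_div]
  split_ifs
  · exact le_rfl
  · exact inv_nonneg.2 (W_pos D y).le

/-- **`Q′*` is the block-constant extension**: `(Q′*ω)(x) = ω(y^j(x))` — the adjoint of the normalised mean for the
pairing (2.69) (weights `(L^jη)^{d+1}`) against the flat fine pairing. [cite: Balaban1984PropagatorsII, (2.69) p.235, p.248 («Q*»)] -/
theorem QsB_apply (ω : ↥(bset D) → ℝ) (x : ↥(boxDom (N0 ℓ Mh k P))) : QsB D ω x = ω (blkOf D x) := by
  classical
  unfold QsB
  change (1 : ℝ)⁻¹ * ∑ b, W D b * qB D b x * ω b = ω (blkOf D x)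
  rw [inv_one, one_mul]
  rw [Finset.sum_eq_single (blkOf D x)]
  · unfold qB; rw [if_pos rfl, mul_inv_cancel₀ (W_pos D _).ne', one_mul]
  · intro b _ hb
    unfold qB; rw [if_neg (Ne.symm hb), mul_zero, zero_mul]
  · intro h; exact absurd (Finset.mem_univ _) h

/-- **`(Q′λ)(y)` is the block mean**: `(Q′λ)(y) = W(y)⁻¹·Σ_{x∈B^j(y)}λ(x)`. [cite: Balaban1984PropagatorsII, (2.14)–(2.15) p.225] -/
theorem QB_apply (lam : ↥(boxDom (N0 ℓ Mh k P)) → ℝ) (y : ↥(bset D)) :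
    QB D lam y = (W D y)⁻¹ * ∑ x ∈ Finset.univ.filter (fun x => blkOf D x = y), lam x := by
  classical
  unfold QB
  rw [avgOp_apply, Finset.mul_sum, Finset.sum_filter]
  refine Finset.sum_congr rfl fun x _ => ?_
  unfold qB
  split_ifs <;> simp

variable (a : ℕ → ℝ)

/-- **THE (2.69)-KERNEL `X(y, y′)` OF `Q′G′²Q′*`** for the genuine `k`-level `G′ = gml`:
`X = kernelW W (Q′∘G′∘G′∘Q′*)`, i.e. `(Q′G′²Q′*ω)(y) = Σ_{y′}W(y′)X(y, y′)ω(y′)` (`kerOp_Xk`).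
[cite: Balaban1984PropagatorsII, (2.68)–(2.69) p.235] -/
def Xk : ↥(bset D) → ↥(bset D) → ℝ :=
  kernelW (W D) (QB D ∘ₗ Matrix.toLin' (gml (N0 ℓ Mh k P) ℓ k D.lev a) ∘ₗ
    Matrix.toLin' (gml (N0 ℓ Mh k P) ℓ k D.lev a) ∘ₗ QsB D)

/-- the operator with (2.69)-kernel `X` IS `Q′G′²Q′*`. [cite: Balaban1984PropagatorsII, (2.69) p.235] -/
theorem kerOp_Xk :
    kerOp (W D) (Xk D a) = QB D ∘ₗ Matrix.toLin' (gml (N0 ℓ Mh k P) ℓ k D.lev a) ∘ₗ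
      Matrix.toLin' (gml (N0 ℓ Mh k P) ℓ k D.lev a) ∘ₗ QsB D :=
  kerOp_kernelW (fun y => (W_pos D y).ne') _

end Data

/-! ## §2 The geometry of the `k`-level Proposition 2.3 chain -/

section GeometryB

variable {ℓ Mh k R : ℕ} {P : Fin (d + 1) → ℕ} (D : Domains d ℓ Mh k P R)

/-- **THE GEOMETRY OF THE CHAIN**: `geom D` (sites `𝔅`, `d` = (2.46) realised as the bond-graph distance, scale = level,
`L`, `η = 1`) with print's `M := L·M_h` (the big-block size in units of the blocks of its level) and `R := R − 1/(L·M_h)`,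
so that `R·M = R·L·M_h − 1` is the walk constant with which the tree certifies (2.60) (`levelGap`). The localisation
vocabulary of `B6.Geometry` is not used (trivial fields, inherited). [cite: Balaban1984PropagatorsII, (2.1)–(2.2) p.224, (2.45)–(2.46) p.231, (2.60) p.234] -/
def geomB : B6.Geometry :=
  { geom D with
    R := (R : ℝ) - 1 / (((ℓ : ℝ) + 1) * Mh)
    M := ((ℓ : ℝ) + 1) * Mh }

/-- `geomB` has the sites of `geom`. [cite: Balaban1984PropagatorsII, (2.45) p.231, dictionary] -/
@[simp] theorem geomB_Site : (geomB D).Site = ↥(bset D) := rfl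

/-- the sites `𝔅` of `geomB` have decidable equality (that of the block labels). [cite: Balaban1984PropagatorsII, (2.45) p.231, dictionary] -/
instance instDecidableEqGeomBSite : DecidableEq (geomB D).Site := inferInstanceAs (DecidableEq ↥(bset D))
/-- … the distance of `geom`. [cite: Balaban1984PropagatorsII, (2.46) p.231, dictionary] -/
theorem geomB_dist : (geomB D).dist = (geom D).dist := rfl
/-- … the lengths of `geom`. [cite: Balaban1984PropagatorsII, (2.1) p.224, dictionary] -/
theorem geomB_len (y : ↥(bset D)) : (geomB D).len y = ((ℓ : ℝ) + 1) ^ y.1.1 * 1 := rfl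
/-- … `L`. [cite: Balaban1984PropagatorsII, (2.1) p.224, dictionary] -/
theorem geomB_L : (geomB D).L = (ℓ : ℝ) + 1 := rfl
/-- … `η = 1`. [cite: Balaban1984PropagatorsII, (2.1) p.224, dictionary] -/
theorem geomB_eta : (geomB D).eta = 1 := rfl
/-- … `M = L·M_h`. [cite: Balaban1984PropagatorsII, (2.2) p.224 («M is a size of big blocks»), dictionary] -/
theorem geomB_M : (geomB D).M = ((ℓ : ℝ) + 1) * Mh := rfl
/-- … `R = R − 1/(L·M_h)`. [cite: Balaban1984PropagatorsII, (2.2) p.224 («R is a big positive integer»), (2.60) p.234, dictionary] -/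
theorem geomB_R : (geomB D).R = (R : ℝ) - 1 / (((ℓ : ℝ) + 1) * Mh) := rfl

/-- **the product `R·M = R·L·M_h − 1`** (the walk constant of `levelGap`). [cite: Balaban1984PropagatorsII, (2.60) p.234, (2.2) p.224] -/
theorem geomB_RM (hMh : 1 ≤ Mh) : (geomB D).R * (geomB D).M = (R : ℝ) * (((ℓ : ℝ) + 1) * Mh) - 1 := by
  rw [geomB_R, geomB_M]
  have hM : (((ℓ : ℝ) + 1) * Mh) ≠ 0 := by
    have : (1 : ℝ) ≤ Mh := by exact_mod_cast hMh
    positivity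
  field_simp

/-- `R·M ≥ 0` once `R·L·M_h ≥ 1`. [cite: Balaban1984PropagatorsII, (2.2) p.224, dictionary] -/
theorem geomB_RM_nonneg (hMh : 1 ≤ Mh) (hRM : 1 ≤ R * ((ℓ + 1) * Mh)) : 0 ≤ (geomB D).R * (geomB D).M := by
  rw [geomB_RM D hMh]
  have : (1 : ℝ) ≤ (R : ℝ) * (((ℓ : ℝ) + 1) * Mh) := by exact_mod_cast hRM
  linarith

/-- the contour system realising `geomB`: lattice points = the blocks, bonds = `bond D` (as for `geom`).
[cite: Balaban1984PropagatorsII, (2.46) p.231] -/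
def csysB : ContourSystem (geomB D) := ⟨↥(bset D), bond D, id, fun s => s.1.1, fun _ => rfl⟩

/-- `geomB` is realised by `csysB` ((2.46) holds by definition). [cite: Balaban1984PropagatorsII, (2.46) p.231] -/
theorem realizesB : Realizes (geomB D) (csysB D) := fun _ _ => rfl

/-- **(2.54)** for `geomB`. [cite: Balaban1984PropagatorsII, (2.54) p.233] -/
theorem triangleB (hMh : 1 ≤ Mh) (hP : ∀ μ, 1 ≤ P μ) : B6RandomWalk.Triangle254 (geomB D) :=
  triangle254_of_realizes (realizesB D) (connected hMh hP)

/-- symmetry of `d` for `geomB`. [cite: Balaban1984PropagatorsII, (2.46) p.231] -/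
theorem symmB : B6Ineq268.Symm (geomB D) := fun y y' => dist_comm_of_realizes (realizesB D) y y'

/-- `d(y, y) = 0` and `d ≥ 0` for `geomB`. [cite: Balaban1984PropagatorsII, (2.46) p.231] -/
theorem refl_nonnegB : (∀ y : (geomB D).Site, (geomB D).dist y y = 0) ∧
    (∀ y y' : (geomB D).Site, 0 ≤ (geomB D).dist y y') :=
  ⟨B6Geometry.dist_self_of_realizes (realizesB D), B6Geometry.dist_nonneg_of_realizes (realizesB D)⟩

/-- **(2.60) IN THE METRIC FORM `LevelSep` FOR `geomB`**: `(R·L·M_h − 1)·max{|j − j′| − 1, 0} ≤ d(y, y′)`, from the walk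
form of (2.2) (`levelGap`) through `B6Geometry.ineq260_of_levelGap`. [cite: Balaban1984PropagatorsII, (2.60) p.234, (2.2) p.224, (2.57) p.233] -/
theorem levelSepB (hMh : 1 ≤ Mh) (hP : ∀ μ, 1 ≤ P μ) (hRM : 1 ≤ R * ((ℓ + 1) * Mh)) :
    B6Ineq268.LevelSep (geomB D) := by
  have h1 : (0 : ℝ) < 1 * 1 := by norm_num
  refine (B6Ineq268.levelSep_iff_ineq260 (g := geomB D) h1).mpr ?_
  refine ineq260_of_levelGap (realizesB D) (connected hMh hP) (levelGap D) ?_ h1.le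
  show (geomB D).R * (geomB D).M ≤ ((R * ((ℓ + 1) * Mh) - 1 : ℕ) : ℝ)
  rw [geomB_RM D hMh, Nat.cast_sub hRM]
  push_cast
  exact le_rfl

end GeometryB

/-! ## §3 (2.68) for the genuine `k`-level operator -/

section Ineq268

/-- **[B6] (2.68) FOR THE GENUINE `k`-LEVEL OPERATOR `G′ = Δ′_a⁻¹` ON A BOX.**  There are `δ₀, C, M₀, N₀ > 0` (functions
of `d`, `L` and the weight window) such that for every `k ≥ 1`, `M_h ≥ 3` with `M = L·M_h ≥ M₀`, `R ≥ 2L` with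
`R·M ≥ N₀ + 1`, every box `P`, every nested family `D` satisfying (2.1)–(2.2) and every windowed weight sequence with
`a_{i+1} = aNext ℓ a_i c_i`, the (2.69)-kernel `X` of `Q′G′²Q′*` obeys, for all `y ∈ Λ_j`, `y′ ∈ Λ_{j′}`:
`|X(y, y′)| ≤ C·(L^j)⁴·((L^{j′})^{d+1})⁻¹·e^{−¼δ₀d(y,y′)}` («|(Q′G′²Q′*)(y, y′)| ≤ O(1)(L^jη)⁴(L^{j′}η)^{−d}e^{−¼δ₀d(y,y′)}»)
and, equivalently, `|(L^{j′})^{d+1}·X(y, y′)| ≤ C·(L^j)⁴·e^{−½(½δ₀)d(y,y′)}`; here `δ₀` is the (2.67)₁ rate of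
`prop22_first_multiLevelBox` (majorant `e^{−½δ₀d}`), so the rate is halved exactly as printed.  Route = the print's, by
`B6Ineq268From267.ineq268_of_267` on the `k`-level (2.67)₁, `lemma21_box` (α = ¼) and `levelGap` (2.60).
[cite: Balaban1984PropagatorsII, (2.68) p.235; Prop. 2.2 (2.67) p.234; Lemma 2.1 (2.60)–(2.61) p.234] -/
theorem ineq268_multiLevelBox (d ℓ : ℕ) (hℓ : 1 ≤ ℓ) (aminus aplus a2minus a2plus : ℝ) (ha : 0 < aminus)
    (ha2 : 0 < a2minus) :
    ∃ δ₀ C M₀ : ℝ, ∃ N₀ : ℕ, 0 < δ₀ ∧ 0 < C ∧ 0 < M₀ ∧ 0 < N₀ ∧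
      ∀ (k Mh R : ℕ), 3 ≤ Mh → M₀ ≤ ((ℓ : ℝ) + 1) * Mh → 2 * (ℓ + 1) ≤ R → N₀ + 1 ≤ R * ((ℓ + 1) * Mh) →
      ∀ (P : Fin (d + 1) → ℕ) (_hP : ∀ μ, 1 ≤ P μ) (D : Domains d ℓ Mh k P R) (a c : ℕ → ℝ),
        (∀ i, aminus ≤ a i ∧ a i ≤ aplus) → (∀ i, a2minus ≤ c i ∧ c i ≤ a2plus) →
        (∀ i, a (i + 1) = aNext ℓ (a i) (c i)) →
        ∀ y y' : ↥(bset D),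
          |Xk D a y y'| ≤ C * ((geom D).len y) ^ 4 * (((geom D).len y') ^ (d + 1))⁻¹ *
              Real.exp (-(δ₀ / 4 * (geom D).dist y y')) ∧
          |(geom D).len y' ^ (d + 1) * Xk D a y y'| ≤
            C * ((geom D).len y) ^ 4 * Real.exp (-(1 / 2 * (δ₀ / 2) * (geom D).dist y y')) := by
  obtain ⟨δ₀, C, M₀, N₀, hδ₀, hC, hM₀, hN₀, hmaj⟩ :=
    prop22_first_multiLevelBox d ℓ hℓ aminus aplus a2minus a2plus ha ha2
  have hL0 : (0 : ℝ) < (ℓ : ℝ) + 1 := by positivity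
  have hL1 : (1 : ℝ) ≤ (ℓ : ℝ) + 1 := by linarith [(Nat.cast_nonneg ℓ : (0 : ℝ) ≤ ℓ)]
  -- the (2.59)-type threshold for Lemma 2.1 at `α = ¼` and for `L² ≤ e^{¼δ₀(RM − 1)}`
  set N₁ : ℕ := ⌈32 * ((d : ℝ) + 1) * ((ℓ : ℝ) + 1) / δ₀⌉₊ + 1 with hN₁
  have hN₁pos : 0 < N₁ := by rw [hN₁]; omega
  have hN₁ge : 32 * ((d : ℝ) + 1) * ((ℓ : ℝ) + 1) / δ₀ < (N₁ : ℝ) := by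
    rw [hN₁]; push_cast
    exact lt_of_le_of_lt (Nat.le_ceil _) (by linarith)
  have hN₁ge' : 32 * ((d : ℝ) + 1) * ((ℓ : ℝ) + 1) < δ₀ * (N₁ : ℝ) := by
    rw [div_lt_iff₀ hδ₀] at hN₁ge; linarith
  have hlog : Real.log ((ℓ : ℝ) + 1) ≤ (ℓ : ℝ) + 1 := (Real.log_le_sub_one_of_pos hL0).trans (by linarith)
  have hlog0 : 0 ≤ Real.log ((ℓ : ℝ) + 1) := Real.log_nonneg hL1
  have hθlt : Real.exp (-(1 / 4 * δ₀)) * ((ℓ : ℝ) + 1) ^ ((2 * (d + 1 : ℕ) : ℝ) / N₁) < 1 := by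
    refine theta_lt_one_of_log hL0 hN₁pos ?_
    push_cast
    have hd0 : (0 : ℝ) ≤ 2 * ((d : ℝ) + 1) := by positivity
    nlinarith [mul_le_mul_of_nonneg_left hlog hd0]
  -- the (2.61)-constant at `α = ¼` and the O(1) of (2.68)
  set cK : ℝ := K261 N₁ (d + 1) ((ℓ : ℝ) + 1) 1 (1 / 4 * δ₀) with hcK
  have hcK0 : 0 ≤ cK := K261_nonneg (by positivity) zero_le_one
  set C' : ℝ := C ^ 2 * (((ℓ : ℝ) + 1) ^ 2 * cK) + 1 with hC'
  have hC'pos : 0 < C' := by positivity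
  refine ⟨δ₀, C', M₀, max N₀ N₁, hδ₀, hC'pos, hM₀, lt_of_lt_of_le hN₀ (le_max_left _ _), ?_⟩
  intro k Mh R hMh hM hR hRM P hP D a c haw hcw hac y y'
  have hMh1 : 1 ≤ Mh := le_trans (by norm_num) hMh
  have hRM0 : N₀ + 1 ≤ R * ((ℓ + 1) * Mh) := le_trans (Nat.succ_le_succ (le_max_left _ _)) hRM
  have hRM1 : N₁ + 1 ≤ R * ((ℓ + 1) * Mh) := le_trans (Nat.succ_le_succ (le_max_right _ _)) hRM
  have hRMone : 1 ≤ R * ((ℓ + 1) * Mh) := le_trans (by omega) hRM1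
  -- the genuine (2.67)₁ majorant of `G′`
  have hmajD := hmaj k Mh R hMh hM hR hRM0 P hP D a c haw hcw hac
  -- Lemma 2.1 at `α = ¼` on the box, (2.54), symmetry, (2.60)
  obtain ⟨-, h261, -, -⟩ := lemma21_box D hMh1 hP hN₁pos hRM1 hδ₀.le (α := 1 / 4) (by norm_num) (by norm_num) hθlt
  have h261B : B6Lemma21Repaired.Ineq261With cK (geomB D) δ₀ (1 / 4) := by
    intro z; have := h261 z; rw [hcK]; exact this
  have htri := triangleB D hMh1 hP
  have hsymm := symmB D
  have hsep := levelSepB D hMh1 hP hRMone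
  have hRMnn := geomB_RM_nonneg D hMh1 hRMone
  -- the threshold `L² ≤ e^{¼δ₀(RM − 1)}`
  have hthr : (geomB D).L ^ 2 ≤ Real.exp (1 / 4 * δ₀ * (geomB D).R * (geomB D).M) := by
    have hprod : 1 / 4 * δ₀ * (geomB D).R * (geomB D).M = 1 / 4 * δ₀ * ((R : ℝ) * (((ℓ : ℝ) + 1) * Mh) - 1) := by
      rw [mul_assoc (1 / 4 * δ₀), geomB_RM D hMh1]
    rw [hprod, geomB_L]
    have hge : (N₁ : ℝ) ≤ (R : ℝ) * (((ℓ : ℝ) + 1) * Mh) - 1 := by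
      have : ((N₁ + 1 : ℕ) : ℝ) ≤ ((R * ((ℓ + 1) * Mh) : ℕ) : ℝ) := by exact_mod_cast hRM1
      push_cast at this; linarith
    have h2 : 2 * Real.log ((ℓ : ℝ) + 1) ≤ 1 / 4 * δ₀ * ((R : ℝ) * (((ℓ : ℝ) + 1) * Mh) - 1) := by
      have hd1 : (1 : ℝ) ≤ (d : ℝ) + 1 := by linarith [(Nat.cast_nonneg d : (0 : ℝ) ≤ d)]
      nlinarith [mul_le_mul_of_nonneg_left hge (by positivity : (0 : ℝ) ≤ 1 / 4 * δ₀)]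
    calc ((ℓ : ℝ) + 1) ^ 2 = Real.exp (2 * Real.log ((ℓ : ℝ) + 1)) := by
          rw [← Real.exp_log (pow_pos hL0 2), Real.log_pow]; norm_num
      _ ≤ _ := Real.exp_le_exp.2 h2
  -- (2.67)₁ in the operator form of `ineq268_of_267`
  have h267 : ∀ (b b' : (geomB D).Site) (J : ↥(boxDom (N0 ℓ Mh k P)) → ℝ) (B : ℝ),
      (∀ x, J x ≠ 0 → blkOf D x = b') → (∀ x, |J x| ≤ B) →
      ∀ x, blkOf D x = b → |Matrix.toLin' (gml (N0 ℓ Mh k P) ℓ k D.lev a) J x| ≤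
        C * (geomB D).len b ^ 2 * Real.exp (-(1 / 2 * δ₀ * (geomB D).dist b b')) * B := by
    intro b b' J B hJ hB x hx
    have hB0 : 0 ≤ B := (abs_nonneg _).trans (hB x)
    have hBS : BlockSupp (g := geom D) (blkOf D) J b' B :=
      ⟨hB0, fun x' _ => hB x', fun x' hx' => by by_contra h; exact hx' (hJ x' h)⟩
    have h := hmajD b' J B hBS x
    rw [hx] at h
    have hK : C * ((ℓ : ℝ) + 1) ^ (2 * b.1.1) * Real.exp (-(δ₀ / 2 * (geom D).dist b b')) =
        C * (geomB D).len b ^ 2 * Real.exp (-(1 / 2 * δ₀ * (geomB D).dist b b')) := by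
      rw [geomB_len, geomB_dist, mul_one, ← pow_mul, mul_comm b.1.1 2]
      congr 2; ring_nf
    rw [← hK]; exact h
  -- p01's kernel-checked (2.67)₁ ⟹ (2.68)
  have h268 := B6Ineq268From267.ineq268_of_267 (geomB D) (d + 1)
    (Matrix.toLin' (gml (N0 ℓ Mh k P) ℓ k D.lev a)) (qB D) (blkOf D) (wX := 1) (C := C) (δ₀ := δ₀) (κ₁ := 1)
    (κ₂ := 1) (c := cK) one_pos (by rw [geomB_eta]; exact one_pos) hC.le zero_le_one
    (fun b x h => qB_ne_zero D h) (sum_abs_qB_le D) (fun b x => abs_qB_le D b x) h267 htri hsymm hsep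
    (by rw [geomB_L]; exact hL1) hRMnn hδ₀.le h261B hthr y y'
  -- bookkeeping: `X = kernelW W (Q′G′G′Q′*)` literally, and the constants
  have hXdef : Xk D a y y' = kernelW (fun z => (geomB D).len z ^ (d + 1))
      (avgOp (qB D) ∘ₗ Matrix.toLin' (gml (N0 ℓ Mh k P) ℓ k D.lev a) ∘ₗ
        Matrix.toLin' (gml (N0 ℓ Mh k P) ℓ k D.lev a) ∘ₗ avgAdj 1 (fun z => (geomB D).len z ^ (d + 1)) (qB D)) y y' := rfl
  have hlen : ∀ z, (geomB D).len z = (geom D).len z := fun z => rfl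
  have hleny : 0 < (geom D).len y := by rw [geom_len, mul_one]; positivity
  have hleny' : 0 < (geom D).len y' := by rw [geom_len, mul_one]; positivity
  have hmain : |Xk D a y y'| ≤ C' * (geom D).len y ^ 4 * ((geom D).len y' ^ (d + 1))⁻¹ *
      Real.exp (-(δ₀ / 4 * (geom D).dist y y')) := by
    rw [hXdef]
    refine h268.trans ?_
    rw [hlen, hlen, geomB_dist, geomB_L]
    have hrate : (1 : ℝ) / 4 * δ₀ * (geom D).dist y y' = δ₀ / 4 * (geom D).dist y y' := by ring
    rw [hrate]
    have hrest : 0 ≤ (geom D).len y ^ 4 * ((geom D).len y' ^ (d + 1))⁻¹ * Real.exp (-(δ₀ / 4 * (geom D).dist y y')) := by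
      positivity
    have hc : 1 * 1 * C ^ 2 * (((ℓ : ℝ) + 1) ^ 2 * cK) ≤ C' := by rw [hC']; linarith
    calc 1 * 1 * C ^ 2 * (((ℓ : ℝ) + 1) ^ 2 * cK) * (geom D).len y ^ 4 * ((geom D).len y' ^ (d + 1))⁻¹ *
          Real.exp (-(δ₀ / 4 * (geom D).dist y y'))
        = 1 * 1 * C ^ 2 * (((ℓ : ℝ) + 1) ^ 2 * cK) * ((geom D).len y ^ 4 * ((geom D).len y' ^ (d + 1))⁻¹ *
          Real.exp (-(δ₀ / 4 * (geom D).dist y y'))) := by ring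
      _ ≤ C' * ((geom D).len y ^ 4 * ((geom D).len y' ^ (d + 1))⁻¹ * Real.exp (-(δ₀ / 4 * (geom D).dist y y'))) :=
          mul_le_mul_of_nonneg_right hc hrest
      _ = _ := by ring
  refine ⟨hmain, ?_⟩
  -- the weighted form (hypothesis `hX` of the Prop. 2.3 assembly at its rate `½δ₀`)
  have hWpos : 0 < (geom D).len y' ^ (d + 1) := pow_pos hleny' _
  rw [abs_mul, abs_of_pos hWpos]
  have hrate2 : (1 : ℝ) / 2 * (δ₀ / 2) * (geom D).dist y y' = δ₀ / 4 * (geom D).dist y y' := by ring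
  rw [hrate2]
  calc (geom D).len y' ^ (d + 1) * |Xk D a y y'|
      ≤ (geom D).len y' ^ (d + 1) * (C' * (geom D).len y ^ 4 * ((geom D).len y' ^ (d + 1))⁻¹ *
          Real.exp (-(δ₀ / 4 * (geom D).dist y y'))) := mul_le_mul_of_nonneg_left hmain hWpos.le
    _ = C' * (geom D).len y ^ 4 * Real.exp (-(δ₀ / 4 * (geom D).dist y y')) := by
        field_simp

end Ineq268

end

end Literature.MathematicalPhysics.QuantumFieldTheory.Balaban1983to89.B6Ineq268MultiLevelBoxL0
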